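import Mathlib
import Summits.Ventures.PercRepro.PuncturedLYMTypeLiftFamily
import Summits.Ventures.PercRepro.PuncturedLYMCoHypMain

/-!
# PercRepro — (SP) FOR `1` PAIRWISE DISJOINT PAIRS AND `3` PAIRWISE DISJOINT QUADRUPLES AT LEVEL `4`: COUNTING COORDINATES
(p10, gen 41)

The members are indexed by `Fin 4`: the first `1` are pairs, the last `3` quadruples (`sz`). `cnt2 v a` / `cnt4 v a` count
the pair / quadruple coordinates of a type `a : Fin 4 → ℕ` equal to `v`; a sum over the coordinates grouped by (size, value)
(`sum_eq_cnt`), the counts add up to `1` / `3` (`cnt2_add`, `cnt4_add`), the coordinates add up to `Σ v · cnt` (`sum_coords`),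
changing one coordinate moves the counts by indicators (`cnt2_update`, `cnt4_update`); the direction code of a member of size `s`
met in `v` points (`code`); the binomials as polynomials at `n = m' + 5`; the trivial case of (SP) on at most `4` points.
Nothing here asserts (SP).
-/

namespace PercRepro.PuncturedLYM.Split.TypeLift.MixP1Q3

open Finset

/-- The member sizes: the first `1` members are pairs, the other `3` quadruples. -/
def sz (i : Fin 4) : ℕ := if (i : ℕ) < 1 then 2 else 4

/-- Every member is a pair or a quadruple. -/
theorem sz_cases (i : Fin 4) : sz i = 2 ∨ sz i = 4 := by
  unfold sz; split_ifs <;> simp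

/-- The pairs. -/
theorem sz_of_lt {i : Fin 4} (h : (i : ℕ) < 1) : sz i = 2 := by unfold sz; rw [if_pos h]

/-- The quadruples. -/
theorem sz_of_ge {i : Fin 4} (h : ¬ (i : ℕ) < 1) : sz i = 4 := by unfold sz; rw [if_neg h]

/-- The index set of the pairs. -/
def grp2 : Finset (Fin 4) := univ.filter (fun i => (i : ℕ) < 1)

/-- The index set of the quadruples. -/
def grp4 : Finset (Fin 4) := univ.filter (fun i => ¬ (i : ℕ) < 1)

/-- There are `1` pairs. -/
theorem card_grp2 : grp2.card = 1 := by decide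

/-- There are `3` quadruples. -/
theorem card_grp4 : grp4.card = 3 := by decide

/-- The sizes add up to `14`. -/
theorem sum_sz : ∑ i : Fin 4, sz i = 14 := by decide

/-- The number of pair coordinates equal to `v`. -/
def cnt2 (v : ℕ) (a : Fin 4 → ℕ) : ℕ := (grp2.filter (fun i => a i = v)).card

/-- The number of quadruple coordinates equal to `v`. -/
def cnt4 (v : ℕ) (a : Fin 4 → ℕ) : ℕ := (grp4.filter (fun i => a i = v)).card

/-- The direction code of a member of size `s` met in `v` points: `v` for pairs, `2 + v` for quadruples (`6` is free). -/
def code (s v : ℕ) : ℕ := if s = 2 then v else 2 + v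

/-- The code of a pair direction. -/
theorem code_fst (v : ℕ) : code 2 v = v := by simp [code]

/-- The code of a quadruple direction. -/
theorem code_snd (v : ℕ) : code 4 v = 2 + v := by simp [code]

/-- The pair coordinates of a type with `a i < sz i` lie in `range 2`. -/
theorem maps_grp2 (a : Fin 4 → ℕ) (ha : ∀ i, a i < sz i) : ∀ i ∈ grp2, a i ∈ range 2 := fun i hi => mem_range.2 (by
  have := ha i; rw [sz_of_lt (mem_filter.1 hi).2] at this; exact this)

/-- The quadruple coordinates of a type with `a i < sz i` lie in `range 4`. -/
theorem maps_grp4 (a : Fin 4 → ℕ) (ha : ∀ i, a i < sz i) : ∀ i ∈ grp4, a i ∈ range 4 := fun i hi => mem_range.2 (by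
  have := ha i; rw [sz_of_ge (mem_filter.1 hi).2] at this; exact this)

/-- A sum over the coordinates of a type with `a i < sz i`, grouped by (size, value). -/
theorem sum_eq_cnt (a : Fin 4 → ℕ) (ha : ∀ i, a i < sz i) (g : ℕ → ℕ → ℚ) :
    ∑ i, g (sz i) (a i) = (cnt2 0 a : ℚ) * g 2 0 + (cnt2 1 a : ℚ) * g 2 1 +
      ((cnt4 0 a : ℚ) * g 4 0 + (cnt4 1 a : ℚ) * g 4 1 + (cnt4 2 a : ℚ) * g 4 2 + (cnt4 3 a : ℚ) * g 4 3) := by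
  rw [← sum_filter_add_sum_filter_not univ (fun i : Fin 4 => (i : ℕ) < 1)]
  congr 1
  · show ∑ i ∈ grp2, g (sz i) (a i) = _
    rw [← sum_fiberwise_of_maps_to (maps_grp2 a ha)]
    have h : ∀ j ∈ range 2, ∑ i ∈ grp2.filter (fun i => a i = j), g (sz i) (a i) = (cnt2 j a : ℚ) * g 2 j := by
      intro j _
      rw [sum_congr rfl (fun i hi => by rw [(mem_filter.1 hi).2, sz_of_lt (mem_filter.1 (mem_filter.1 hi).1).2]),
        sum_const, nsmul_eq_mul]
      rfl
    rw [sum_congr rfl h]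
    simp [sum_range_succ]
  · show ∑ i ∈ grp4, g (sz i) (a i) = _
    rw [← sum_fiberwise_of_maps_to (maps_grp4 a ha)]
    have h : ∀ j ∈ range 4, ∑ i ∈ grp4.filter (fun i => a i = j), g (sz i) (a i) = (cnt4 j a : ℚ) * g 4 j := by
      intro j _
      rw [sum_congr rfl (fun i hi => by rw [(mem_filter.1 hi).2, sz_of_ge (mem_filter.1 (mem_filter.1 hi).1).2]),
        sum_const, nsmul_eq_mul]
      rfl
    rw [sum_congr rfl h]
    simp [sum_range_succ]

/-- The pair counts add up to `1`. -/
theorem cnt2_add (a : Fin 4 → ℕ) (ha : ∀ i, a i < sz i) : cnt2 0 a + cnt2 1 a = 1 := by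
  have h := card_eq_sum_card_fiberwise (maps_grp2 a ha)
  rw [card_grp2] at h
  simp only [sum_range_succ, sum_range_zero, zero_add] at h
  unfold cnt2
  omega

/-- The quadruple counts add up to `3`. -/
theorem cnt4_add (a : Fin 4 → ℕ) (ha : ∀ i, a i < sz i) : cnt4 0 a + cnt4 1 a + cnt4 2 a + cnt4 3 a = 3 := by
  have h := card_eq_sum_card_fiberwise (maps_grp4 a ha)
  rw [card_grp4] at h
  simp only [sum_range_succ, sum_range_zero, zero_add] at h
  unfold cnt4
  omega

/-- The sum of the coordinates is `Σ v · cnt`. -/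
theorem sum_coords (a : Fin 4 → ℕ) (ha : ∀ i, a i < sz i) :
    ∑ i, a i = cnt2 1 a + cnt4 1 a + 2 * cnt4 2 a + 3 * cnt4 3 a := by
  have h : ∑ i, ((a i : ℕ) : ℚ) = (cnt2 0 a : ℚ) * ((0 : ℕ) : ℚ) + (cnt2 1 a : ℚ) * ((1 : ℕ) : ℚ) +
      ((cnt4 0 a : ℚ) * ((0 : ℕ) : ℚ) + (cnt4 1 a : ℚ) * ((1 : ℕ) : ℚ) + (cnt4 2 a : ℚ) * ((2 : ℕ) : ℚ) + (cnt4 3 a : ℚ) * ((3 : ℕ) : ℚ)) :=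
    sum_eq_cnt a ha (fun _ v => (v : ℚ))
  have h' : ((∑ i, a i : ℕ) : ℚ) = ((cnt2 1 a + cnt4 1 a + 2 * cnt4 2 a + 3 * cnt4 3 a : ℕ) : ℚ) := by
    push_cast
    rw [h]
    push_cast
    ring
  exact_mod_cast h'

/-- Changing one coordinate: the count of `v` among the pairs moves by the indicators of the old and the new value. -/
theorem cnt2_update (v : ℕ) (a : Fin 4 → ℕ) (i : Fin 4) (x : ℕ) :
    cnt2 v (Function.update a i x) + (if (i : ℕ) < 1 ∧ a i = v then 1 else 0) =
      cnt2 v a + (if (i : ℕ) < 1 ∧ x = v then 1 else 0) := by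
  unfold cnt2 grp2
  rw [filter_filter, filter_filter, card_filter, card_filter, ← sum_erase_add _ _ (mem_univ i),
    ← sum_erase_add _ _ (mem_univ i)]
  have h : ∑ j ∈ univ.erase i, (if (j : ℕ) < 1 ∧ Function.update a i x j = v then 1 else 0) =
      ∑ j ∈ univ.erase i, (if (j : ℕ) < 1 ∧ a j = v then 1 else 0) := by
    refine sum_congr rfl (fun j hj => ?_)
    rw [Function.update_of_ne (mem_erase.1 hj).1]
  rw [h]
  simp only [Function.update_self]
  ring

/-- Changing one coordinate: the count of `v` among the quadruples moves by the indicators of the old and the new value. -/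
theorem cnt4_update (v : ℕ) (a : Fin 4 → ℕ) (i : Fin 4) (x : ℕ) :
    cnt4 v (Function.update a i x) + (if ¬ (i : ℕ) < 1 ∧ a i = v then 1 else 0) =
      cnt4 v a + (if ¬ (i : ℕ) < 1 ∧ x = v then 1 else 0) := by
  unfold cnt4 grp4
  rw [filter_filter, filter_filter, card_filter, card_filter, ← sum_erase_add _ _ (mem_univ i),
    ← sum_erase_add _ _ (mem_univ i)]
  have h : ∑ j ∈ univ.erase i, (if ¬ (j : ℕ) < 1 ∧ Function.update a i x j = v then 1 else 0) =
      ∑ j ∈ univ.erase i, (if ¬ (j : ℕ) < 1 ∧ a j = v then 1 else 0) := by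
    refine sum_congr rfl (fun j hj => ?_)
    rw [Function.update_of_ne (mem_erase.1 hj).1]
  rw [h]
  simp only [Function.update_self]
  ring

/-! ### The cardinalities -/

/-- `C(n, 4)` as a polynomial, `n = m' + 5`. -/
theorem choose_l_cast (m' : ℕ) :
    (((m' + 5).choose 4 : ℕ) : ℚ) = ((m' : ℚ) + 5) * ((m' : ℚ) + 4) * ((m' : ℚ) + 3) * ((m' : ℚ) + 2) / 24 := by
  have h := Nat.descFactorial_eq_factorial_mul_choose (m' + 5) 4
  simp only [Nat.descFactorial_succ, Nat.descFactorial_zero, Nat.factorial, mul_one] at h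
  rw [show m' + 5 - 3 = m' + 2 by omega, show m' + 5 - 2 = m' + 3 by omega, show m' + 5 - 1 = m' + 4 by omega, show m' + 5 - 0 = m' + 5 by omega] at h
  have h' := congrArg (fun x : ℕ => (x : ℚ)) h
  push_cast at h'
  linarith

/-- `C(n, 5)` as a polynomial, `n = m' + 5`. -/
theorem choose_l1_cast (m' : ℕ) :
    (((m' + 5).choose 5 : ℕ) : ℚ) = ((m' : ℚ) + 5) * ((m' : ℚ) + 4) * ((m' : ℚ) + 3) * ((m' : ℚ) + 2) * ((m' : ℚ) + 1) / 120 := by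
  have h := Nat.descFactorial_eq_factorial_mul_choose (m' + 5) 5
  simp only [Nat.descFactorial_succ, Nat.descFactorial_zero, Nat.factorial, mul_one] at h
  rw [show m' + 5 - 4 = m' + 1 by omega, show m' + 5 - 3 = m' + 2 by omega, show m' + 5 - 2 = m' + 3 by omega, show m' + 5 - 1 = m' + 4 by omega, show m' + 5 - 0 = m' + 5 by omega] at h
  have h' := congrArg (fun x : ℕ => (x : ℚ)) h
  push_cast at h'
  linarith

/-- `C(n − 2, 2)` as a polynomial, `n = m' + 5`. -/
theorem choose_mA_cast (m' : ℕ) :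
    (((m' + 3).choose 2 : ℕ) : ℚ) = ((m' : ℚ) + 3) * ((m' : ℚ) + 2) / 2 := by
  have h := Nat.descFactorial_eq_factorial_mul_choose (m' + 3) 2
  simp only [Nat.descFactorial_succ, Nat.descFactorial_zero, Nat.factorial, mul_one] at h
  rw [show m' + 3 - 1 = m' + 2 by omega, show m' + 3 - 0 = m' + 3 by omega] at h
  have h' := congrArg (fun x : ℕ => (x : ℚ)) h
  push_cast at h'
  linarith

/-- `C(n − 4, 0)` as a polynomial, `n = m' + 5`. -/
theorem choose_mB_cast (m' : ℕ) : (((m' + 1).choose 0 : ℕ) : ℚ) = 1 := by simp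

section Trivial

variable {α : Type} [Fintype α]

/-- With at most `4` points there is no column, and (SP) holds for every `D`. -/
theorem puncturedNMP_of_card_le [DecidableEq α] (D : Finset (Finset α)) (hn : Fintype.card α ≤ 4) :
    PuncturedNMP 4 D := by
  intro 𝒜 _
  have h : levelAbove α 4 = ∅ := by
    unfold levelAbove
    rw [powersetCard_eq_empty, card_univ]
    omega
  rw [h, card_empty, mul_zero]
  exact Nat.zero_le _

end Trivial

end PercRepro.PuncturedLYM.Split.TypeLift.MixP1Q3
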